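import Literature.NumberTheory.Automorphic.HarishChandraLeviIntegral
import Literature.NumberTheory.Automorphic.HarishChandraGLAntipode
import HarnessLib

/-!
# `Z(𝔪)` is integral over `Z(𝔤)` modulo `U(𝔤)𝔲`: the real forms `𝔤𝔩_n(ℝ)`, `𝔤𝔩_n(ℂ)`

Topic `NumberTheory/Automorphic`; sequel of `HarishChandraLeviIntegral`, descending its main theorem
from the complexification `U(∏_τ 𝔤𝔩_{k+l}(ℂ))` to the REAL enveloping algebra
`U_ℝ = U(𝔤𝔩_{k+l}(𝕜))` (`𝕜 = ℝ` or `ℂ`, `[RCLike 𝕜]`), which is the algebra acting on automorphic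
forms by Lie derivatives (`ArchimedeanCalculus`, with `𝔤 = 𝔤𝔩_n(K_w)` at an archimedean place `w`).

* `inclLeftR`, `inclRightR` — the real block embeddings `𝔤𝔩_k(𝕜), 𝔤𝔩_l(𝕜) → 𝔤𝔩_{k+l}(𝕜)`;
  `jLeftR`, `jRightR` — the induced maps on real enveloping algebras; `envHom_jLeftR` — they
  complexify to `jLeft`, `jRight` of `HarishChandraLeviBlocks` (`envHom` of `HarishChandraGLIsomorphism`).
* `uBlockR` — the real nilradical `𝔲 ⊆ 𝔤𝔩_{k+l}(𝕜)` (upper right block); `uIdealR = U_ℝ·𝔲`, the left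
  ideal; `uIdeal_le_map_envHomC` — the complex `U(𝔤_ℂ)𝔲_ℂ` is generated by the image of `U_ℝ𝔲`.
* `exists_monic_mem_uIdealR_of_envHom_eq` — **main theorem, real form**: if `u ∈ U_ℝ` complexifies
  to an element of the centre `Z(U(𝔤𝔩_k^T)) ⊗ Z(U(𝔤𝔩_l^T))` of `U(𝔪_ℂ)`, there are `d` and REAL
  central `c₀, …, c_{d-1} ∈ Z(U_ℝ)` with `u^d + ∑_{i<d} c_i u^i ∈ U_ℝ𝔲`. Proof: the complex
  relation (`exists_monic_mem_uIdeal_gl`) is pulled back along `ℂ ⊗_ℝ U_ℝ ≅ U(𝔤_ℂ)` (`envHomC`),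
  conjugated (complex conjugation on the first factor fixes `1 ⊗ u` and `U_ℝ𝔲`), the monic
  polynomial is multiplied with its conjugate (coefficients in the commutative algebra
  `ℂ ⊗_ℝ Z(U_ℝ)`; the product has conjugation-invariant, hence real, coefficients), and the real
  part `reT` of `HarishChandraGLIsomorphism` maps `(ℂ ⊗ U_ℝ)·𝔲` onto `U_ℝ𝔲`.
* `exists_monic_mem_uIdealR_jLeftR`, `exists_monic_mem_uIdealR_jRightR` — **for every central
  `z ∈ Z(U(𝔤𝔩_k(𝕜)))` (resp. `Z(U(𝔤𝔩_l(𝕜)))`), its image in `U(𝔤𝔩_{k+l}(𝕜))` satisfies a monic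
  polynomial with coefficients in `Z(U(𝔤𝔩_{k+l}(𝕜)))` modulo the left ideal `U·𝔲`.** This is the
  statement "`𝔷^M` is a finitely generated `i(𝔷)`-module" (Moeglin–Waldspurger 1995, I.2.17, [HC2];
  Harish-Chandra) in the form used for constant terms: on functions on `N(𝔸)\G(𝔸)` the left ideal
  `U·𝔲` acts by zero through left translations, so `Z(𝔪)` acts algebraically on the constant terms
  of `Z(𝔤)`-finite functions (Borel–Jacquet 1979, 4.3–4.4).

* the right-ideal forms `exists_monic_mem_uRightR_jLeftR/jRightR` (`uRightR = 𝔲·U_ℝ`; the form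
  adapted to right-invariant derivatives), obtained through the antipode `antiR` of
  `HarishChandraGLAntipode` (`ι X ↦ -ι X`; here: involutive, on powers and sums — `antiR_antiR`,
  `antiR_pow`, `antiR_sum` — and compatible with the block maps, `antiR_jLeftR`, `antiR_jRightR`).

Everything here is proved: definitions and theorems only, no named fact.

## References

* C. Moeglin, J.-L. Waldspurger, *Spectral decomposition and Eisenstein series* (1995), I.2.17
  [MoeglinWaldspurger1995].
* Harish-Chandra, *Automorphic forms on semisimple Lie groups*, LNM 62 (1968), §2–§4
  [HarishChandra1968].
* A. Borel, H. Jacquet, *Automorphic forms and automorphic representations* (1979), 4.3–4.4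
  [BorelJacquet1979].
* A. W. Knapp, D. A. Vogan, *Cohomological Induction and Unitary Representations* (1995), §IV.8
  [KnappVogan1995].
-/

noncomputable section

-- Mathlib idiom (Mathlib/Algebra/Lie/OfAssociative.lean): commutator brackets on associative algebras
attribute [local instance 100] LieRing.ofAssociativeRing

open UniversalEnvelopingAlgebra TensorProduct Literature.Algebra.Lie.PBW Literature.Algebra.Lie.ChevalleyGL
open scoped ComplexConjugate

namespace Literature.NumberTheory.Automorphic.HCLevi

open HCCore HCEmb RCLike

/-! ### Block diagonal matrices over a general coefficient ring -/

section BlockDiag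

variable {R : Type*} [CommRing R] {k l : ℕ}

variable (R) in
/-- The block diagonal matrix `diag(X, Y)` over a commutative ring, indexed by `Fin (k + l)`.
[folklore] -/
def blockDiag' (X : Matrix (Fin k) (Fin k) R) (Y : Matrix (Fin l) (Fin l) R) : Matrix (Fin (k + l)) (Fin (k + l)) R :=
  Matrix.reindex finSumFinEquiv finSumFinEquiv (Matrix.fromBlocks X 0 0 Y)

/-- Entries in the first diagonal block. [folklore] -/
@[simp]
theorem blockDiag'_castAdd_castAdd (X : Matrix (Fin k) (Fin k) R) (Y : Matrix (Fin l) (Fin l) R) (a b : Fin k) :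
    blockDiag' R X Y (Fin.castAdd l a) (Fin.castAdd l b) = X a b := by
  simp [blockDiag']

/-- Entries in the upper right block vanish. [folklore] -/
@[simp]
theorem blockDiag'_castAdd_natAdd (X : Matrix (Fin k) (Fin k) R) (Y : Matrix (Fin l) (Fin l) R) (a : Fin k) (b : Fin l) :
    blockDiag' R X Y (Fin.castAdd l a) (Fin.natAdd k b) = 0 := by
  simp [blockDiag']

/-- Entries in the lower left block vanish. [folklore] -/
@[simp]
theorem blockDiag'_natAdd_castAdd (X : Matrix (Fin k) (Fin k) R) (Y : Matrix (Fin l) (Fin l) R) (a : Fin l) (b : Fin k) :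
    blockDiag' R X Y (Fin.natAdd k a) (Fin.castAdd l b) = 0 := by
  simp [blockDiag']

/-- Entries in the second diagonal block. [folklore] -/
@[simp]
theorem blockDiag'_natAdd_natAdd (X : Matrix (Fin k) (Fin k) R) (Y : Matrix (Fin l) (Fin l) R) (a b : Fin l) :
    blockDiag' R X Y (Fin.natAdd k a) (Fin.natAdd k b) = Y a b := by
  simp [blockDiag']

/-- `diag` is additive. [folklore] -/
theorem blockDiag'_add (X X' : Matrix (Fin k) (Fin k) R) (Y Y' : Matrix (Fin l) (Fin l) R) :
    blockDiag' R (X + X') (Y + Y') = blockDiag' R X Y + blockDiag' R X' Y' := by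
  ext i j
  simp only [blockDiag', Matrix.reindex_apply, Matrix.submatrix_apply, Matrix.add_apply]
  rw [← Matrix.add_apply, Matrix.fromBlocks_add]
  simp only [add_zero]

/-- `diag` is homogeneous. [folklore] -/
theorem blockDiag'_smul {S : Type*} [SMulZeroClass S R] (c : S) (X : Matrix (Fin k) (Fin k) R) (Y : Matrix (Fin l) (Fin l) R) :
    blockDiag' R (c • X) (c • Y) = c • blockDiag' R X Y := by
  ext i j
  simp only [blockDiag', Matrix.reindex_apply, Matrix.submatrix_apply, Matrix.smul_apply]
  rw [← Matrix.smul_apply, Matrix.fromBlocks_smul]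
  induction i using Fin.addCases <;> induction j using Fin.addCases <;> simp

/-- `diag` is compatible with subtraction. [folklore] -/
theorem blockDiag'_sub (X X' : Matrix (Fin k) (Fin k) R) (Y Y' : Matrix (Fin l) (Fin l) R) :
    blockDiag' R (X - X') (Y - Y') = blockDiag' R X Y - blockDiag' R X' Y' := by
  rw [eq_sub_iff_add_eq, ← blockDiag'_add, sub_add_cancel, sub_add_cancel]

/-- `diag` is multiplicative. [folklore] -/
theorem blockDiag'_mul (X X' : Matrix (Fin k) (Fin k) R) (Y Y' : Matrix (Fin l) (Fin l) R) :
    blockDiag' R X Y * blockDiag' R X' Y' = blockDiag' R (X * X') (Y * Y') := by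
  simp [blockDiag', Matrix.fromBlocks_multiply]

end BlockDiag

variable {𝕜 : Type*} (k l : ℕ)

local notation "glR[" m "]" => Matrix (Fin m) (Fin m) 𝕜
local notation "UR[" m "]" => UniversalEnvelopingAlgebra ℝ (Matrix (Fin m) (Fin m) 𝕜)
local notation "UC[" m "]" => UniversalEnvelopingAlgebra ℂ (𝔤 (𝕜 →ₐ[ℝ] ℂ) m)

/-! ### The real block embeddings over a commutative real algebra of coefficients -/

section GenericBlocks

variable [CommRing 𝕜] [Algebra ℝ 𝕜]

/-- The real embedding of the first block `𝔤𝔩_k(𝕜) → 𝔤𝔩_{k+l}(𝕜)`, `X ↦ diag(X, 0)` (a real Lie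
algebra homomorphism; `𝕜` any commutative real algebra of coefficients, e.g. `ℝ`, `ℂ`, `K ⊗_ℚ ℝ`). [folklore] -/
def inclLeftR : glR[k] →ₗ⁅ℝ⁆ glR[k + l] where
  toFun X := blockDiag' 𝕜 X 0
  map_add' X Y := by rw [← blockDiag'_add, add_zero]
  map_smul' c X := by rw [RingHom.id_apply, ← blockDiag'_smul, smul_zero]
  map_lie' {X Y} := by
    rw [LieRing.of_associative_ring_bracket, LieRing.of_associative_ring_bracket, blockDiag'_mul, blockDiag'_mul,
      ← blockDiag'_sub, mul_zero, sub_zero]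

/-- The real embedding of the second block `𝔤𝔩_l(𝕜) → 𝔤𝔩_{k+l}(𝕜)`, `Y ↦ diag(0, Y)`. [folklore] -/
def inclRightR : glR[l] →ₗ⁅ℝ⁆ glR[k + l] where
  toFun Y := blockDiag' 𝕜 0 Y
  map_add' X Y := by rw [← blockDiag'_add, add_zero]
  map_smul' c X := by rw [RingHom.id_apply, ← blockDiag'_smul, smul_zero]
  map_lie' {X Y} := by
    rw [LieRing.of_associative_ring_bracket, LieRing.of_associative_ring_bracket, blockDiag'_mul, blockDiag'_mul,
      ← blockDiag'_sub, mul_zero, sub_zero]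

variable {k l}

/-- Unfolding `inclLeftR`. [folklore] -/
theorem inclLeftR_apply (X : glR[k]) : inclLeftR k l X = blockDiag' 𝕜 X 0 := rfl

/-- Unfolding `inclRightR`. [folklore] -/
theorem inclRightR_apply (Y : glR[l]) : inclRightR k l Y = blockDiag' 𝕜 0 Y := rfl

variable (k l)

/-- The real algebra map `U(𝔤𝔩_k(𝕜)) → U(𝔤𝔩_{k+l}(𝕜))` induced by the first block. [folklore] -/
def jLeftR : UR[k] →ₐ[ℝ] UR[k + l] :=
  UniversalEnvelopingAlgebra.lift ℝ ((ι ℝ).comp (inclLeftR k l))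

/-- The real algebra map `U(𝔤𝔩_l(𝕜)) → U(𝔤𝔩_{k+l}(𝕜))` induced by the second block. [folklore] -/
def jRightR : UR[l] →ₐ[ℝ] UR[k + l] :=
  UniversalEnvelopingAlgebra.lift ℝ ((ι ℝ).comp (inclRightR k l))

variable {k l}

/-- `jLeftR` on generators. [folklore] -/
@[simp]
theorem jLeftR_ι (X : glR[k]) : jLeftR k l (ι ℝ X) = ι ℝ (inclLeftR k l X) := lift_ι_apply ℝ _ X

/-- `jRightR` on generators. [folklore] -/
@[simp]
theorem jRightR_ι (Y : glR[l]) : jRightR k l (ι ℝ Y) = ι ℝ (inclRightR k l Y) := lift_ι_apply ℝ _ Y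

variable (k l)

/-- The real nilradical `𝔲` of the maximal parabolic `𝔭_k ⊆ 𝔤𝔩_{k+l}(𝕜)`: matrices supported on the
upper right `k × l` block. Knapp 2002, §V.7. [folklore] -/
def uBlockR : Submodule ℝ glR[k + l] where
  carrier := {X | ∀ a b : Fin (k + l), ¬((a : ℕ) < k ∧ k ≤ (b : ℕ)) → X a b = 0}
  zero_mem' _ _ _ := rfl
  add_mem' {X Y} hX hY a b h := by rw [Matrix.add_apply, hX a b h, hY a b h, add_zero]
  smul_mem' c X hX a b h := by rw [Matrix.smul_apply, hX a b h, smul_zero]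

/-- **The left ideal `U_ℝ·𝔲`** of `U(𝔤𝔩_{k+l}(𝕜))` generated by `ι(𝔲)`. [cite: KnappVogan1995, (4.123)] -/
def uIdealR : Ideal UR[k + l] :=
  Ideal.span ((ι ℝ) '' (uBlockR (𝕜 := 𝕜) k l : Set glR[k + l]))

variable {k l}

/-- Elementary matrices in the upper right block lie in `𝔲`. [folklore] -/
theorem single_mem_uBlockR {a b : Fin (k + l)} (hab : (a : ℕ) < k ∧ k ≤ (b : ℕ)) (c : 𝕜) :
    Matrix.single a b c ∈ uBlockR (𝕜 := 𝕜) k l := by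
  intro a' b' h
  rw [Matrix.single_apply, if_neg]
  rintro ⟨rfl, rfl⟩
  exact h hab

/-- `ι(X) ∈ U_ℝ𝔲` for `X ∈ 𝔲`. [folklore] -/
theorem ι_mem_uIdealR {X : glR[k + l]} (hX : X ∈ uBlockR k l) : ι ℝ X ∈ uIdealR (𝕜 := 𝕜) k l :=
  Ideal.subset_span ⟨X, hX, rfl⟩

variable (k l) in
/-- The left ideal of `ℂ ⊗_ℝ U_ℝ` generated by `1 ⊗ ι(𝔲)`. [folklore] -/
def uIdealA : Ideal (ℂ ⊗[ℝ] UR[k + l]) :=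
  Ideal.span ((fun X : glR[k + l] ↦ (1 : ℂ) ⊗ₜ[ℝ] ι ℝ X) '' (uBlockR (𝕜 := 𝕜) k l : Set glR[k + l]))

/-- `1 ⊗ ι(X) ∈ uIdealA` for `X ∈ 𝔲`. [folklore] -/
theorem tmul_ι_mem_uIdealA {X : glR[k + l]} (hX : X ∈ uBlockR k l) :
    (1 : ℂ) ⊗ₜ[ℝ] ι ℝ X ∈ uIdealA (𝕜 := 𝕜) k l :=
  Ideal.subset_span ⟨X, hX, rfl⟩

/-- The right ideal `𝔲·U_ℝ ⊆ U(𝔤𝔩_{k+l}(𝕜))` generated by `ι(𝔲)`: the span of the products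
`ι(X) · a`, `X ∈ 𝔲` (a real subspace stable under right multiplication). This is the ideal that acts
by zero, through RIGHT Lie derivatives at points of `P(K_∞)`, on functions left invariant under
`N(𝔸)` (the words ending — i.e. applied last — with a letter of `𝔲`). [cite: KnappVogan1995, (4.123)] -/
def uRightR (k l : ℕ) : Submodule ℝ UR[k + l] :=
  Submodule.span ℝ {w | ∃ X ∈ uBlockR (𝕜 := 𝕜) k l, ∃ a : UR[k + l], ι ℝ X * a = w}

/-- `𝔲·U_ℝ` is stable under right multiplication. [folklore] -/
theorem mul_mem_uRightR {w : UR[k + l]} (hw : w ∈ uRightR (𝕜 := 𝕜) k l) (b : UR[k + l]) :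
    w * b ∈ uRightR (𝕜 := 𝕜) k l := by
  induction hw using Submodule.span_induction with
  | mem x hx =>
    obtain ⟨X, hX, a, rfl⟩ := hx
    exact Submodule.subset_span ⟨X, hX, a * b, by rw [mul_assoc]⟩
  | zero => rw [zero_mul]; exact Submodule.zero_mem _
  | add x y _ _ hx hy => rw [add_mul]; exact Submodule.add_mem _ hx hy
  | smul c x _ hx => rw [smul_mul_assoc]; exact Submodule.smul_mem _ c hx

end GenericBlocks

/-! ### The antipode `antiR` (of `HarishChandraGLAntipode`) and the block data -/

section AntipodeRight

variable [RCLike 𝕜] {k l} {m : ℕ}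

/-- `S 1 = 1`. [folklore] -/
theorem antiR_one : antiR (1 : UR[m]) = 1 := by
  rw [← map_one (algebraMap ℝ UR[m]), antiR_algebraMap]

/-- `S 0 = 0`. [folklore] -/
theorem antiR_zero : antiR (0 : UR[m]) = 0 := by
  rw [← zero_smul ℝ (0 : UR[m]), antiR_smul, zero_smul, zero_smul]

/-- The antipode is an involution. [folklore] -/
theorem antiR_antiR (u : UR[m]) : antiR (antiR u) = u := by
  induction u using Literature.Algebra.Lie.UEnv.induction_on with
  | algebraMap r => rw [antiR_algebraMap, antiR_algebraMap]
  | ι_mem X => rw [antiR_ι, ← neg_one_smul ℝ, antiR_smul, antiR_ι, smul_neg, neg_one_smul, neg_neg]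
  | mul a b ha hb => rw [antiR_mul, antiR_mul, ha, hb]
  | add a b ha hb => rw [antiR_add, antiR_add, ha, hb]

/-- The antipode on powers. [folklore] -/
theorem antiR_pow (u : UR[m]) (i : ℕ) : antiR (u ^ i) = antiR u ^ i := by
  induction i with
  | zero => rw [pow_zero, pow_zero, antiR_one]
  | succ i ih => rw [pow_succ, antiR_mul, ih, ← pow_succ']

/-- The antipode on finite sums. [folklore] -/
theorem antiR_sum {ι' : Type*} (s : Finset ι') (g : ι' → UR[m]) :
    antiR (∑ i ∈ s, g i) = ∑ i ∈ s, antiR (g i) := by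
  classical
  induction s using Finset.induction_on with
  | empty => rw [Finset.sum_empty, Finset.sum_empty, antiR_zero]
  | insert a s ha ih => rw [Finset.sum_insert ha, Finset.sum_insert ha, antiR_add, ih]

/-- **The antipode maps the left ideal `U_ℝ·𝔲` into the right ideal `𝔲·U_ℝ`.** [folklore] -/
theorem antiR_mem_uRightR {w : UR[k + l]} (hw : w ∈ uIdealR (𝕜 := 𝕜) k l) :
    antiR w ∈ uRightR (𝕜 := 𝕜) k l := by
  induction hw using Submodule.span_induction with
  | mem x hx =>
    obtain ⟨X, hX, rfl⟩ := hx
    rw [antiR_ι]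
    refine Submodule.subset_span ⟨X, hX, -1, ?_⟩
    rw [mul_neg_one]
  | zero => rw [antiR_zero]; exact Submodule.zero_mem _
  | add x y _ _ hx hy => rw [antiR_add]; exact Submodule.add_mem _ hx hy
  | smul c x _ hx => rw [smul_eq_mul, antiR_mul]; exact mul_mem_uRightR hx _

/-- The antipodes commute with `jLeftR`. [folklore] -/
theorem antiR_jLeftR (u : UR[k]) : antiR (jLeftR k l u) = jLeftR k l (antiR u) := by
  induction u using Literature.Algebra.Lie.UEnv.induction_on with
  | algebraMap r => rw [AlgHom.commutes, antiR_algebraMap, antiR_algebraMap, AlgHom.commutes]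
  | ι_mem X => rw [jLeftR_ι, antiR_ι, antiR_ι, map_neg, jLeftR_ι]
  | mul a b ha hb => rw [map_mul, antiR_mul, antiR_mul, ha, hb, map_mul]
  | add a b ha hb => rw [map_add, antiR_add, antiR_add, ha, hb, map_add]

/-- The antipodes commute with `jRightR`. [folklore] -/
theorem antiR_jRightR (u : UR[l]) : antiR (jRightR k l u) = jRightR k l (antiR u) := by
  induction u using Literature.Algebra.Lie.UEnv.induction_on with
  | algebraMap r => rw [AlgHom.commutes, antiR_algebraMap, antiR_algebraMap, AlgHom.commutes]
  | ι_mem X => rw [jRightR_ι, antiR_ι, antiR_ι, map_neg, jRightR_ι]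
  | mul a b ha hb => rw [map_mul, antiR_mul, antiR_mul, ha, hb, map_mul]
  | add a b ha hb => rw [map_add, antiR_add, antiR_add, ha, hb, map_add]

/-- Transport of a monic relation through the antipode: from `S(w)^d + ∑ c_i S(w)^i ∈ U_ℝ·𝔲` to
`w^d + ∑ S(c_i) w^i ∈ 𝔲·U_ℝ`. [folklore] -/
theorem exists_monic_mem_uRightR_of_antiR {w : UR[k + l]}
    (h : ∃ (d : ℕ) (c : ℕ → UR[k + l]), (∀ i, c i ∈ Subalgebra.center ℝ UR[k + l]) ∧
      antiR w ^ d + ∑ i ∈ Finset.range d, c i * antiR w ^ i ∈ uIdealR k l) :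
    ∃ (d : ℕ) (c : ℕ → UR[k + l]), (∀ i, c i ∈ Subalgebra.center ℝ UR[k + l]) ∧
      w ^ d + ∑ i ∈ Finset.range d, c i * w ^ i ∈ uRightR (𝕜 := 𝕜) k l := by
  obtain ⟨d, c, hc, hmem⟩ := h
  refine ⟨d, fun i ↦ antiR (c i), fun i ↦ antiR_mem_center (hc i), ?_⟩
  have h1 := antiR_mem_uRightR hmem
  rw [antiR_add, antiR_pow, antiR_antiR, antiR_sum] at h1
  have e : ∀ i ∈ Finset.range d, antiR (c i * antiR w ^ i) = antiR (c i) * w ^ i := by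
    intro i _
    rw [antiR_mul, antiR_pow, antiR_antiR, Subalgebra.mem_center_iff.mp (antiR_mem_center (hc i))]
  rwa [Finset.sum_congr rfl e] at h1

end AntipodeRight

/-! ### Conjugation on `ℂ ⊗_ℝ M` -/

section Conj

variable {B : Type*} [Ring B] [Algebra ℝ B]

variable (B) in
/-- Complex conjugation on the first factor of `ℂ ⊗_ℝ B`, a real algebra automorphism. [folklore] -/
def conjT : ℂ ⊗[ℝ] B →ₐ[ℝ] ℂ ⊗[ℝ] B :=
  Algebra.TensorProduct.map (Complex.conjAe.toAlgHom) (AlgHom.id ℝ B)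

/-- `conjT (c ⊗ b) = conj c ⊗ b`. [folklore] -/
@[simp]
theorem conjT_tmul (c : ℂ) (b : B) : conjT B (c ⊗ₜ b) = conj c ⊗ₜ b := rfl

/-- `conjT` is an involution. [folklore] -/
theorem conjT_conjT (x : ℂ ⊗[ℝ] B) : conjT B (conjT B x) = x := by
  induction x using TensorProduct.induction_on with
  | zero => rw [map_zero, map_zero]
  | tmul c b => rw [conjT_tmul, conjT_tmul, Complex.conj_conj]
  | add x y hx hy => rw [map_add, map_add, hx, hy]

/-- `conjT` fixes `1 ⊗ b`. [folklore] -/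
theorem conjT_one_tmul (b : B) : conjT B ((1 : ℂ) ⊗ₜ b) = (1 : ℂ) ⊗ₜ b := by
  rw [conjT_tmul, map_one]

variable {M : Type*} [AddCommGroup M] [Module ℝ M]

/-- `i ⊗ m = 0` forces `m = 0` (apply the imaginary part). [folklore] -/
theorem eq_zero_of_I_tmul_eq_zero {m : M} (h : (Complex.I : ℂ) ⊗ₜ[ℝ] m = 0) : m = 0 := by
  have h1 := congrArg (imT M) h
  rwa [imT_tmul, map_zero, Complex.I_im, one_smul] at h1

/-- **Real points of `ℂ ⊗_ℝ B`**: an element fixed by conjugation is `1 ⊗ re(x)`. [folklore] -/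
theorem eq_one_tmul_reT_of_conjT_eq {x : ℂ ⊗[ℝ] B} (hx : conjT B x = x) : x = (1 : ℂ) ⊗ₜ reT B x := by
  have hdec := tmul_reT_add_tmul_imT (M := B) x
  have hconj : conjT B x = (1 : ℂ) ⊗ₜ reT B x - Complex.I ⊗ₜ imT B x := by
    conv_lhs => rw [← hdec]
    rw [map_add, conjT_tmul, conjT_tmul, map_one, Complex.conj_I, TensorProduct.neg_tmul, ← sub_eq_add_neg]
  have him : imT B x = 0 := by
    have h2 : (2 : ℝ) • ((Complex.I : ℂ) ⊗ₜ[ℝ] imT B x) = 0 := by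
      have h3 : ((1 : ℂ) ⊗ₜ[ℝ] reT B x + Complex.I ⊗ₜ imT B x) -
          ((1 : ℂ) ⊗ₜ[ℝ] reT B x - Complex.I ⊗ₜ imT B x) = 0 := by
        rw [hdec, ← hconj, hx, sub_self]
      rw [two_smul, ← h3]
      abel
    exact eq_zero_of_I_tmul_eq_zero ((smul_eq_zero.mp h2).resolve_left two_ne_zero)
  conv_lhs => rw [← hdec, him, TensorProduct.tmul_zero, add_zero]

/-- Conjugation and evaluation of polynomials: if `φ ∘ f = f ∘ ψ` and `φ(W) = W` then
`φ(P(W)) = (P^ψ)(W)`. [folklore] -/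
theorem map_eval₂_eq_eval₂_map {S A : Type*} [CommSemiring S] [Semiring A] (f : S →+* A) (φ : A →+* A) (ψ : S →+* S)
    (hcomp : φ.comp f = f.comp ψ) {W : A} (hW : φ W = W) (P : Polynomial S) :
    φ (P.eval₂ f W) = (P.map ψ).eval₂ f W := by
  rw [Polynomial.hom_eval₂, hcomp, hW, Polynomial.eval₂_map]

end Conj

/-! ### The real forms `𝔤𝔩_n(ℝ)`, `𝔤𝔩_n(ℂ)`: complexification -/

section RC

variable [RCLike 𝕜] {k l}

/-- **The real block embeddings complexify to the complex ones**: `j(diag(X,0)) = diag(j(X), 0)`.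
[folklore] -/
theorem embAlgHom_inclLeftR (X : glR[k]) :
    embAlgHom 𝕜 (k + l) (inclLeftR k l X) = inclLeft (𝕜 →ₐ[ℝ] ℂ) k l (embAlgHom 𝕜 k X) := by
  funext τ
  ext i j
  rw [embAlgHom_apply, inclLeftR_apply, inclLeft_apply]
  induction i using Fin.addCases with
  | left a =>
    induction j using Fin.addCases with
    | left b => rw [blockDiag'_castAdd_castAdd, blockDiag_castAdd_castAdd, embAlgHom_apply]
    | right b => rw [blockDiag'_castAdd_natAdd, blockDiag_castAdd_natAdd, map_zero]
  | right a =>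
    induction j using Fin.addCases with
    | left b => rw [blockDiag'_natAdd_castAdd, blockDiag_natAdd_castAdd, map_zero]
    | right b => rw [blockDiag'_natAdd_natAdd, blockDiag_natAdd_natAdd, Matrix.zero_apply, Matrix.zero_apply, map_zero]

/-- `j(diag(0,Y)) = diag(0, j(Y))`. [folklore] -/
theorem embAlgHom_inclRightR (Y : glR[l]) :
    embAlgHom 𝕜 (k + l) (inclRightR k l Y) = inclRight (𝕜 →ₐ[ℝ] ℂ) k l (embAlgHom 𝕜 l Y) := by
  funext τ
  ext i j
  rw [embAlgHom_apply, inclRightR_apply, inclRight_apply]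
  induction i using Fin.addCases with
  | left a =>
    induction j using Fin.addCases with
    | left b => rw [blockDiag'_castAdd_castAdd, blockDiag_castAdd_castAdd, Matrix.zero_apply, Matrix.zero_apply, map_zero]
    | right b => rw [blockDiag'_castAdd_natAdd, blockDiag_castAdd_natAdd, map_zero]
  | right a =>
    induction j using Fin.addCases with
    | left b => rw [blockDiag'_natAdd_castAdd, blockDiag_natAdd_castAdd, map_zero]
    | right b => rw [blockDiag'_natAdd_natAdd, blockDiag_natAdd_natAdd, embAlgHom_apply]

/-- **`jLeftR` complexifies to `jLeft`**: `Φ_{k+l} ∘ jLeftR = jLeft ∘ Φ_k` on real enveloping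
algebras (`Φ = envHom`). [folklore] -/
theorem envHom_jLeftR (u : UR[k]) :
    envHom 𝕜 (k + l) (jLeftR k l u) = jLeft (𝕜 →ₐ[ℝ] ℂ) k l (envHom 𝕜 k u) := by
  have h : (envHom 𝕜 (k + l)).comp (jLeftR k l) =
      ((jLeft (𝕜 →ₐ[ℝ] ℂ) k l).restrictScalars ℝ).comp (envHom 𝕜 k) := by
    refine UniversalEnvelopingAlgebra.hom_ext (h := LieHom.ext fun X ↦ ?_)
    simp only [LieHom.coe_comp, Function.comp_apply, AlgHom.coe_toLieHom, AlgHom.coe_comp, jLeftR_ι, envHom_ι,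
      AlgHom.coe_restrictScalars', jLeft_ι, embAlgHom_inclLeftR]
  exact congr($h u)

/-- **`jRightR` complexifies to `jRight`.** [folklore] -/
theorem envHom_jRightR (u : UR[l]) :
    envHom 𝕜 (k + l) (jRightR k l u) = jRight (𝕜 →ₐ[ℝ] ℂ) k l (envHom 𝕜 l u) := by
  have h : (envHom 𝕜 (k + l)).comp (jRightR k l) =
      ((jRight (𝕜 →ₐ[ℝ] ℂ) k l).restrictScalars ℝ).comp (envHom 𝕜 l) := by
    refine UniversalEnvelopingAlgebra.hom_ext (h := LieHom.ext fun X ↦ ?_)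
    simp only [LieHom.coe_comp, Function.comp_apply, AlgHom.coe_toLieHom, AlgHom.coe_comp, jRightR_ι, envHom_ι,
      AlgHom.coe_restrictScalars', jRight_ι, embAlgHom_inclRightR]
  exact congr($h u)

/-- `Φ` maps the real centre into the complex centre. [folklore] -/
theorem envHom_mem_center {m : ℕ} {z : UR[m]} (hz : z ∈ Subalgebra.center ℝ UR[m]) :
    envHom 𝕜 m z ∈ Subalgebra.center ℂ UC[m] := by
  have h := centerHomC_mem_center 𝕜 m ((1 : ℂ) ⊗ₜ ⟨z, hz⟩)
  rwa [centerHomC_tmul, one_smul] at h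

/-- `j` maps the real `𝔲` into the complex `𝔲`. [folklore] -/
theorem embAlgHom_mem_uBlock {X : glR[k + l]} (hX : X ∈ uBlockR k l) :
    embAlgHom 𝕜 (k + l) X ∈ uBlock (𝕜 →ₐ[ℝ] ℂ) k l := by
  intro τ a b h
  rw [embAlgHom_apply, hX a b h, map_zero]

/-- The elementary tuple `(δ_{ττ'} E_{ab})_{τ'}` as a complex combination of `j(E_{ab})` and `j(i E_{ab})`
(primitive idempotents of `𝕜 ⊗_ℝ ℂ`, as in `single_mem_span_emb`). [folklore] -/
theorem pi_single_eq_smul_emb [DecidableEq (𝕜 →ₐ[ℝ] ℂ)] (τ : 𝕜 →ₐ[ℝ] ℂ) (a b : Fin (k + l)) :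
    (Pi.single τ (Matrix.single a b (1 : ℂ)) : (𝕜 →ₐ[ℝ] ℂ) → Matrix (Fin (k + l)) (Fin (k + l)) ℂ) =
      (Fintype.card (𝕜 →ₐ[ℝ] ℂ) : ℂ)⁻¹ • (embAlgHom 𝕜 (k + l) (Matrix.single a b (1 : 𝕜)) +
        conj (τ I) • embAlgHom 𝕜 (k + l) (Matrix.single a b (I : 𝕜))) := by
  funext τ'
  have hmap : ∀ z : 𝕜, embAlgHom 𝕜 (k + l) (Matrix.single a b z) τ' = τ' z • Matrix.single a b (1 : ℂ) := by
    intro z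
    ext c d
    rw [embAlgHom_apply, Matrix.smul_apply, Matrix.single_apply, Matrix.single_apply]
    split_ifs <;> simp
  rw [Pi.single_apply, Pi.smul_apply, Pi.add_apply, Pi.smul_apply, hmap, hmap, map_one, one_smul, smul_smul]
  have e : (Matrix.single a b (1 : ℂ) : Matrix (Fin (k + l)) (Fin (k + l)) ℂ) + (conj (τ I) * τ' I) • Matrix.single a b 1 =
      (1 + conj (τ I) * τ' I) • Matrix.single a b 1 := by rw [add_smul, one_smul]
  rw [e, smul_smul, orthogonality τ τ']
  by_cases h : τ' = τ
  · subst h; simp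
  · rw [if_neg h, if_neg (Ne.symm h), zero_smul]

/-- The standard basis vector `E^τ_{ab}` of `HCCore` is the elementary tuple `(δ_{ττ'} E_{ab})_{τ'}`.
[folklore] -/
theorem stdB_eq_pi_single [DecidableEq (𝕜 →ₐ[ℝ] ℂ)] {m : ℕ} (i : Idx (𝕜 →ₐ[ℝ] ℂ) m) :
    stdB (𝕜 →ₐ[ℝ] ℂ) m i = Pi.single i.1 (Matrix.single i.2.1 i.2.2 (1 : ℂ)) := by
  funext τ
  rw [stdB_apply, Pi.single_apply]
  obtain ⟨τ₀, a, b⟩ := i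
  dsimp only
  by_cases h : τ₀ = τ
  · subst h; simp only [if_true]
  · rw [if_neg h, if_neg (Ne.symm h)]

/-- **The complex ideal `U(𝔤_ℂ)𝔲_ℂ` is generated by the image of the real one**:
`U(𝔤_ℂ)𝔲_ℂ ⊆ Φ_ℂ((ℂ ⊗ U_ℝ)·𝔲)`. [folklore] -/
theorem uIdeal_le_map_envHomC [DecidableEq (𝕜 →ₐ[ℝ] ℂ)] :
    uIdeal (𝕜 →ₐ[ℝ] ℂ) k l ≤ (uIdealA (𝕜 := 𝕜) k l).map (envHomC 𝕜 (k + l)) := by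
  refine Ideal.span_le.mpr ?_
  rintro _ ⟨X, hX, rfl⟩
  rw [eq_sum_of_mem_uBlock hX, map_sum]
  refine Ideal.sum_mem _ fun i _ ↦ ?_
  rw [map_smul]
  by_cases hi : IsU i
  · rw [if_pos hi, Algebra.smul_def]
    refine Ideal.mul_mem_left _ _ ?_
    rw [stdB_eq_pi_single, pi_single_eq_smul_emb, map_smul, map_add, map_smul, Algebra.smul_def, Algebra.smul_def]
    refine Ideal.mul_mem_left _ _ (Ideal.add_mem _ ?_ (Ideal.mul_mem_left _ _ ?_))
    · rw [← envHom_ι, ← one_smul ℂ (envHom 𝕜 (k + l) _), ← envHomC_tmul]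
      exact Ideal.mem_map_of_mem _ (tmul_ι_mem_uIdealA (single_mem_uBlockR hi 1))
    · rw [← envHom_ι, ← one_smul ℂ (envHom 𝕜 (k + l) _), ← envHomC_tmul]
      exact Ideal.mem_map_of_mem _ (tmul_ι_mem_uIdealA (single_mem_uBlockR hi I))
  · rw [if_neg hi, zero_smul]
    exact Ideal.zero_mem _

/-- **The real part maps `(ℂ ⊗ U_ℝ)·𝔲` into `U_ℝ·𝔲`**: `re(a · (1 ⊗ ι X)) = re(a) · ι X`. [folklore] -/
theorem reT_mul_mem_uIdealR {x : ℂ ⊗[ℝ] UR[k + l]} (hx : x ∈ uIdealA (𝕜 := 𝕜) k l) (a : ℂ ⊗[ℝ] UR[k + l]) :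
    reT _ (a * x) ∈ uIdealR (𝕜 := 𝕜) k l := by
  induction hx using Submodule.span_induction generalizing a with
  | mem x hx =>
    obtain ⟨X, hX, rfl⟩ := hx
    rw [(reT_imT_mul (ι ℝ X) a).2.1]
    exact Ideal.mul_mem_left _ _ (ι_mem_uIdealR hX)
  | zero => rw [mul_zero, map_zero]; exact Ideal.zero_mem _
  | add x y _ _ hx hy => rw [mul_add, map_add]; exact Ideal.add_mem _ (hx a) (hy a)
  | smul c x _ hx => rw [smul_eq_mul, ← mul_assoc]; exact hx (a * c)

end RC

/-! ### The main theorem, real form -/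

section Main

variable [RCLike 𝕜] {k l}

local notation "ZR" => Subalgebra.center ℝ (UniversalEnvelopingAlgebra ℝ (Matrix (Fin (k + l)) (Fin (k + l)) 𝕜))
local notation "AR" => ℂ ⊗[ℝ] UniversalEnvelopingAlgebra ℝ (Matrix (Fin (k + l)) (Fin (k + l)) 𝕜)

variable (k l) in
/-- The coefficient map `ℂ ⊗_ℝ Z(U_ℝ) → ℂ ⊗_ℝ U_ℝ` (inclusion of the centre in the second factor).
[folklore] -/
def coefMap : ℂ ⊗[ℝ] ZR →ₐ[ℂ] AR :=
  Algebra.TensorProduct.map (AlgHom.id ℂ ℂ) (Subalgebra.center ℝ (UniversalEnvelopingAlgebra ℝ glR[k + l])).val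

/-- `coefMap` on pure tensors. [folklore] -/
@[simp]
theorem coefMap_tmul (c : ℂ) (z : ZR) : coefMap k l (c ⊗ₜ z) = c ⊗ₜ (z : UR[k + l]) := rfl

local notation "coefRH" => ((coefMap (𝕜 := 𝕜) k l :
  ℂ ⊗[ℝ] Subalgebra.center ℝ (UniversalEnvelopingAlgebra ℝ (Matrix (Fin (k + l)) (Fin (k + l)) 𝕜)) →ₐ[ℂ]
    ℂ ⊗[ℝ] UniversalEnvelopingAlgebra ℝ (Matrix (Fin (k + l)) (Fin (k + l)) 𝕜)) :
  ℂ ⊗[ℝ] Subalgebra.center ℝ (UniversalEnvelopingAlgebra ℝ (Matrix (Fin (k + l)) (Fin (k + l)) 𝕜)) →+*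
    ℂ ⊗[ℝ] UniversalEnvelopingAlgebra ℝ (Matrix (Fin (k + l)) (Fin (k + l)) 𝕜))

/-- `Φ_ℂ ∘ coefMap = centerHomC`. [folklore] -/
theorem envHomC_coefMap (s : ℂ ⊗[ℝ] ZR) : envHomC 𝕜 (k + l) (coefMap k l s) = centerHomC 𝕜 (k + l) s := by
  rw [centerHomC_eq_comp]; rfl

/-- `Φ_ℂ (1 ⊗ u) = Φ u`. [folklore] -/
theorem envHomC_one_tmul {m : ℕ} (u : UR[m]) : envHomC 𝕜 m ((1 : ℂ) ⊗ₜ u) = envHom 𝕜 m u := by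
  rw [envHomC_tmul, one_smul]

/-- The coefficient map takes central values. [folklore] -/
theorem coefMap_comm (s : ℂ ⊗[ℝ] ZR) (a : AR) : coefMap k l s * a = a * coefMap k l s := by
  induction s using TensorProduct.induction_on with
  | zero => rw [map_zero, zero_mul, mul_zero]
  | tmul c z =>
    rw [coefMap_tmul]
    induction a using TensorProduct.induction_on with
    | zero => rw [mul_zero, zero_mul]
    | tmul c' v =>
      rw [Algebra.TensorProduct.tmul_mul_tmul, Algebra.TensorProduct.tmul_mul_tmul, mul_comm c c',
        Subalgebra.mem_center_iff.mp z.2 v]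
    | add x y hx hy => rw [mul_add, add_mul, hx, hy]
  | add x y hx hy => rw [map_add, add_mul, mul_add, hx, hy]

/-- The coefficient map commutes with conjugation. [folklore] -/
theorem coefMap_conjT (s : ℂ ⊗[ℝ] ZR) : coefMap k l (conjT _ s) = conjT _ (coefMap k l s) := by
  induction s using TensorProduct.induction_on with
  | zero => rw [map_zero, map_zero, map_zero]
  | tmul c z => rfl
  | add x y hx hy => simp only [map_add, hx, hy]

/-- Conjugation preserves `(ℂ ⊗ U_ℝ)·𝔲`. [folklore] -/
theorem conjT_mem_uIdealA {x : AR} (hx : x ∈ uIdealA (𝕜 := 𝕜) k l) : conjT _ x ∈ uIdealA (𝕜 := 𝕜) k l := by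
  induction hx using Submodule.span_induction with
  | mem x hx =>
    obtain ⟨X, hX, rfl⟩ := hx
    rw [conjT_one_tmul]
    exact tmul_ι_mem_uIdealA hX
  | zero => rw [map_zero]; exact Ideal.zero_mem _
  | add x y _ _ hx hy => rw [map_add]; exact Ideal.add_mem _ hx hy
  | smul c x _ hx => rw [smul_eq_mul, map_mul]; exact Ideal.mul_mem_left _ _ hx

/-- Powers of `1 ⊗ u`. [folklore] -/
theorem one_tmul_pow {m : ℕ} (u : UR[m]) (i : ℕ) :
    ((1 : ℂ) ⊗ₜ[ℝ] u) ^ i = (1 : ℂ) ⊗ₜ[ℝ] (u ^ i) := by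
  rw [← Algebra.TensorProduct.includeRight_apply u, ← map_pow]
  rfl

/-- Evaluation of `X^d + ∑_{i<d} g_i X^i` at `1 ⊗ u` through the coefficient map. [folklore] -/
theorem eval₂_coefMap_X_pow_add_sum (u : UR[k + l]) (d : ℕ) (g : Fin d → ℂ ⊗[ℝ] ZR) :
    Polynomial.eval₂ coefRH ((1 : ℂ) ⊗ₜ u)
      (Polynomial.X ^ d + ∑ i : Fin d, Polynomial.C (g i) * Polynomial.X ^ (i : ℕ)) =
      ((1 : ℂ) ⊗ₜ u) ^ d + ∑ i : Fin d, coefMap k l (g i) * ((1 : ℂ) ⊗ₜ u) ^ (i : ℕ) := by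
  rw [Polynomial.eval₂_add, Polynomial.eval₂_X_pow, Polynomial.eval₂_finsetSum]
  congr 1
  refine Finset.sum_congr rfl fun i _ ↦ ?_
  rw [Polynomial.C_mul_X_pow_eq_monomial, Polynomial.eval₂_monomial, RingHom.coe_coe]

/-- **Descent of a monic relation from `ℂ ⊗_ℝ U_ℝ` to `U_ℝ`**: if a monic polynomial `P` with
coefficients in the commutative algebra `ℂ ⊗_ℝ Z(U_ℝ)` satisfies `P(1 ⊗ u) ∈ (ℂ ⊗ U_ℝ)·𝔲`, then `u`
satisfies a monic polynomial with REAL central coefficients modulo `U_ℝ·𝔲` (conjugate, multiply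
`P` with its conjugate, take real parts). [folklore] -/
theorem exists_monic_mem_uIdealR_of_eval₂_mem {u : UR[k + l]} {P : Polynomial (ℂ ⊗[ℝ] ZR)} (hP : P.Monic)
    (h : Polynomial.eval₂ coefRH ((1 : ℂ) ⊗ₜ u) P ∈ uIdealA (𝕜 := 𝕜) k l) :
    ∃ (d : ℕ) (c : ℕ → UR[k + l]), (∀ i, c i ∈ Subalgebra.center ℝ UR[k + l]) ∧
      u ^ d + ∑ i ∈ Finset.range d, c i * u ^ i ∈ uIdealR k l := by
  -- the conjugation of the coefficient algebra, as a ring homomorphism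
  let σ : ℂ ⊗[ℝ] ZR →+* ℂ ⊗[ℝ] ZR := (conjT ZR : ℂ ⊗[ℝ] ZR →ₐ[ℝ] ℂ ⊗[ℝ] ZR)
  have hσ : ∀ s, σ s = conjT ZR s := fun _ ↦ rfl
  -- Step 1: the conjugate relation `P^σ(1 ⊗ u) ∈ (ℂ ⊗ U_ℝ)·𝔲`
  have hcomp : ((conjT UR[k + l] : AR →ₐ[ℝ] AR) : AR →+* AR).comp coefRH =
      RingHom.comp coefRH σ :=
    RingHom.ext fun s ↦ (coefMap_conjT s).symm
  have hWfix : conjT UR[k + l] ((1 : ℂ) ⊗ₜ u) = (1 : ℂ) ⊗ₜ u := conjT_one_tmul u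
  have h2 : Polynomial.eval₂ coefRH ((1 : ℂ) ⊗ₜ u) (P.map σ) ∈ uIdealA (𝕜 := 𝕜) k l := by
    rw [← map_eval₂_eq_eval₂_map coefRH ((conjT UR[k + l] : AR →ₐ[ℝ] AR) : AR →+* AR)
      σ hcomp hWfix P]
    exact conjT_mem_uIdealA h
  -- Step 2: the product `R = P · P^σ` is monic, `σ`-fixed, and `R(1 ⊗ u) ∈ (ℂ ⊗ U_ℝ)·𝔲`
  have hσσ : σ.comp σ = RingHom.id _ := RingHom.ext fun s ↦ by
    rw [RingHom.comp_apply, hσ, hσ, conjT_conjT, RingHom.id_apply]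
  have hRmonic : (P * P.map σ).Monic := hP.mul (hP.map σ)
  have hRfix : (P * P.map σ).map σ = P * P.map σ := by
    rw [Polynomial.map_mul, Polynomial.map_map, hσσ, Polynomial.map_id, mul_comm (Polynomial.map σ P) P]
  have hcoef : ∀ m, (P * P.map σ).coeff m = (1 : ℂ) ⊗ₜ reT _ ((P * P.map σ).coeff m) := fun m ↦ by
    refine eq_one_tmul_reT_of_conjT_eq ?_
    have hm := congrArg (fun q ↦ Polynomial.coeff q m) hRfix
    simp only [Polynomial.coeff_map] at hm
    exact hm
  have h3 : Polynomial.eval₂ coefRH ((1 : ℂ) ⊗ₜ u) (P * P.map σ) ∈ uIdealA (𝕜 := 𝕜) k l := by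
    rw [Polynomial.eval₂_mul_noncomm (f := coefRH) (x := (1 : ℂ) ⊗ₜ u) (hf := fun m ↦ coefMap_comm _ _)]
    exact Ideal.mul_mem_left _ _ h2
  -- Step 3: `R(1 ⊗ u) = 1 ⊗ (∑_m re(R_m) u^m)`
  set D := (P * P.map σ).natDegree with hD
  set c : ℕ → ZR := fun m ↦ reT _ ((P * P.map σ).coeff m) with hc
  have h4 : Polynomial.eval₂ coefRH ((1 : ℂ) ⊗ₜ u) (P * P.map σ) =
      (1 : ℂ) ⊗ₜ ∑ m ∈ Finset.range (D + 1), (c m : UR[k + l]) * u ^ m := by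
    rw [Polynomial.eval₂_eq_sum_range, TensorProduct.tmul_sum]
    refine Finset.sum_congr rfl fun m _ ↦ ?_
    rw [hcoef m, RingHom.coe_coe, coefMap_tmul, one_tmul_pow, Algebra.TensorProduct.tmul_mul_tmul, one_mul]
  -- Step 4: real parts
  have h5 : ∑ m ∈ Finset.range (D + 1), (c m : UR[k + l]) * u ^ m ∈ uIdealR k l := by
    have h6 := reT_mul_mem_uIdealR h3 1
    rwa [one_mul, h4, reT_tmul, Complex.one_re, one_smul] at h6
  refine ⟨D, fun m ↦ (c m : UR[k + l]), fun m ↦ (c m).2, ?_⟩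
  have hcD : (c D : UR[k + l]) = 1 := by
    have h7 : (P * P.map σ).coeff D = 1 := hRmonic.coeff_natDegree
    show ((reT _ ((P * P.map σ).coeff D) : ZR) : UR[k + l]) = 1
    rw [h7, Algebra.TensorProduct.one_def, reT_tmul, Complex.one_re, one_smul]
    rfl
  rw [Finset.sum_range_succ, hcD, one_mul] at h5
  have e : u ^ D + ∑ m ∈ Finset.range D, (c m : UR[k + l]) * u ^ m =
      ∑ m ∈ Finset.range D, (c m : UR[k + l]) * u ^ m + u ^ D := add_comm _ _
  rw [e]
  exact h5

/-- **`Z(𝔪)` is integral over `Z(𝔤)` modulo `U·𝔲`, real form.** Let `u ∈ U(𝔤𝔩_{k+l}(𝕜))` be an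
element whose complexification `Φ(u)` is `leviMap(y)` for some `y` in the centre
`Z(U(𝔤𝔩_k^T)) ⊗ Z(U(𝔤𝔩_l^T))` of `U(𝔪_ℂ)` (e.g. the image of a central element of `U(𝔤𝔩_k(𝕜))`,
`exists_monic_mem_uIdealR_jLeftR`). Then there are `d` and central `c₀, …, c_{d-1} ∈ Z(U(𝔤𝔩_{k+l}(𝕜)))`
with `u^d + ∑_{i<d} c_i u^i ∈ U·𝔲` (the left ideal generated by the upper right block).
Harish-Chandra: `Z(𝔪)` is a finitely generated module over `μ_𝔭(Z(𝔤))`; Moeglin–Waldspurger 1995,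
I.2.17 ([HC2]). [cite: MoeglinWaldspurger1995, I.2.17] -/
theorem exists_monic_mem_uIdealR_of_envHom_eq {u : UR[k + l]}
    (y : Subalgebra.center ℂ UC[k] ⊗[ℂ] Subalgebra.center ℂ UC[l])
    (hu : envHom 𝕜 (k + l) u = leviMap (𝕜 →ₐ[ℝ] ℂ) k l
      (Algebra.TensorProduct.map (Subalgebra.center ℂ UC[k]).val (Subalgebra.center ℂ UC[l]).val y)) :
    ∃ (d : ℕ) (c : ℕ → UR[k + l]), (∀ i, c i ∈ Subalgebra.center ℝ UR[k + l]) ∧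
      u ^ d + ∑ i ∈ Finset.range d, c i * u ^ i ∈ uIdealR k l := by
  classical
  obtain ⟨d, cz, hcz, hmem⟩ := exists_monic_mem_uIdeal_gl (𝕜 := 𝕜) k l y
  rw [← hu, Finset.sum_range] at hmem
  choose ζ hζ using fun i ↦ exists_centerHomC_eq_of_mem_center 𝕜 (k + l) (hcz i)
  refine exists_monic_mem_uIdealR_of_eval₂_mem
    (P := Polynomial.X ^ d + ∑ i : Fin d, Polynomial.C (ζ i) * Polynomial.X ^ (i : ℕ))
    (Polynomial.monic_X_pow_add (Polynomial.degree_sum_fin_lt _)) ?_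
  rw [eval₂_coefMap_X_pow_add_sum]
  have himg : envHomC 𝕜 (k + l) (((1 : ℂ) ⊗ₜ u) ^ d + ∑ i : Fin d, coefMap k l (ζ i) * ((1 : ℂ) ⊗ₜ u) ^ (i : ℕ)) ∈
      uIdeal (𝕜 →ₐ[ℝ] ℂ) k l := by
    rw [map_add, map_pow, map_sum, envHomC_one_tmul]
    simp only [map_mul, map_pow, envHomC_one_tmul, envHomC_coefMap, hζ]
    exact hmem
  obtain ⟨x, hx, hxe⟩ := (Ideal.mem_map_iff_of_surjective (envHomC 𝕜 (k + l))
    (envHomC_surjective (𝕜 := 𝕜) (n := k + l))).mp (uIdeal_le_map_envHomC himg)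
  rwa [← envHomC_injective hxe]

/-- **Integrality for the first block**: every central `z ∈ Z(U(𝔤𝔩_k(𝕜)))`, viewed in
`U(𝔤𝔩_{k+l}(𝕜))`, satisfies a monic polynomial with coefficients in `Z(U(𝔤𝔩_{k+l}(𝕜)))` modulo the
left ideal `U·𝔲`. Moeglin–Waldspurger 1995, I.2.17 ("`𝔷^M` is a finitely generated `i(𝔷)`-module").
[cite: MoeglinWaldspurger1995, I.2.17] -/
theorem exists_monic_mem_uIdealR_jLeftR (z : UR[k]) (hz : z ∈ Subalgebra.center ℝ UR[k]) :
    ∃ (d : ℕ) (c : ℕ → UR[k + l]), (∀ i, c i ∈ Subalgebra.center ℝ UR[k + l]) ∧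
      jLeftR k l z ^ d + ∑ i ∈ Finset.range d, c i * jLeftR k l z ^ i ∈ uIdealR k l := by
  refine exists_monic_mem_uIdealR_of_envHom_eq (⟨envHom 𝕜 k z, envHom_mem_center hz⟩ ⊗ₜ 1) ?_
  rw [envHom_jLeftR, Algebra.TensorProduct.map_tmul, leviMap_tmul, map_one, map_one, mul_one]
  rfl

/-- **Integrality for the second block.** [cite: MoeglinWaldspurger1995, I.2.17] -/
theorem exists_monic_mem_uIdealR_jRightR (z : UR[l]) (hz : z ∈ Subalgebra.center ℝ UR[l]) :
    ∃ (d : ℕ) (c : ℕ → UR[k + l]), (∀ i, c i ∈ Subalgebra.center ℝ UR[k + l]) ∧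
      jRightR k l z ^ d + ∑ i ∈ Finset.range d, c i * jRightR k l z ^ i ∈ uIdealR k l := by
  refine exists_monic_mem_uIdealR_of_envHom_eq (1 ⊗ₜ ⟨envHom 𝕜 l z, envHom_mem_center hz⟩) ?_
  rw [envHom_jRightR, Algebra.TensorProduct.map_tmul, leviMap_tmul, map_one, map_one, one_mul]
  rfl

/-- **Integrality for products of the two blocks** (`z₁ z₂`, `z₁ ∈ Z(U(𝔤𝔩_k))`, `z₂ ∈ Z(U(𝔤𝔩_l))`);
together with the two previous theorems this covers generators of the algebra `Z_k · Z_l ⊆ U`.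
[cite: MoeglinWaldspurger1995, I.2.17] -/
theorem exists_monic_mem_uIdealR_jLeftR_mul_jRightR (z₁ : UR[k]) (hz₁ : z₁ ∈ Subalgebra.center ℝ UR[k])
    (z₂ : UR[l]) (hz₂ : z₂ ∈ Subalgebra.center ℝ UR[l]) :
    ∃ (d : ℕ) (c : ℕ → UR[k + l]), (∀ i, c i ∈ Subalgebra.center ℝ UR[k + l]) ∧
      (jLeftR k l z₁ * jRightR k l z₂) ^ d + ∑ i ∈ Finset.range d, c i * (jLeftR k l z₁ * jRightR k l z₂) ^ i ∈
        uIdealR k l := by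
  refine exists_monic_mem_uIdealR_of_envHom_eq
    (⟨envHom 𝕜 k z₁, envHom_mem_center hz₁⟩ ⊗ₜ ⟨envHom 𝕜 l z₂, envHom_mem_center hz₂⟩) ?_
  rw [map_mul, envHom_jLeftR, envHom_jRightR, Algebra.TensorProduct.map_tmul, leviMap_tmul]
  rfl

end Main

/-! ### The right ideal forms for the real forms -/

section RCRight

variable [RCLike 𝕜] {k l}

/-- **Integrality for the first block, right ideal form**: for central `z ∈ Z(U(𝔤𝔩_k(𝕜)))` there
are central `c_i ∈ Z(U(𝔤𝔩_{k+l}(𝕜)))` with `jLeftR(z)^d + ∑_{i<d} c_i jLeftR(z)^i ∈ 𝔲·U_ℝ` (the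
form adapted to right-invariant differential operators: for a smooth `φ` on `G(𝔸)` left invariant
under `N(𝔸)`, every word of `𝔲·U` acts by zero at the points of `P(K_∞) × G(𝔸_f)`).
Moeglin–Waldspurger 1995, I.2.17. [cite: MoeglinWaldspurger1995, I.2.17] -/
theorem exists_monic_mem_uRightR_jLeftR (z : UR[k]) (hz : z ∈ Subalgebra.center ℝ UR[k]) :
    ∃ (d : ℕ) (c : ℕ → UR[k + l]), (∀ i, c i ∈ Subalgebra.center ℝ UR[k + l]) ∧
      jLeftR k l z ^ d + ∑ i ∈ Finset.range d, c i * jLeftR k l z ^ i ∈ uRightR (𝕜 := 𝕜) k l := by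
  refine exists_monic_mem_uRightR_of_antiR ?_
  rw [antiR_jLeftR]
  exact exists_monic_mem_uIdealR_jLeftR _ (antiR_mem_center hz)

/-- **Integrality for the second block, right ideal form.** [cite: MoeglinWaldspurger1995, I.2.17] -/
theorem exists_monic_mem_uRightR_jRightR (z : UR[l]) (hz : z ∈ Subalgebra.center ℝ UR[l]) :
    ∃ (d : ℕ) (c : ℕ → UR[k + l]), (∀ i, c i ∈ Subalgebra.center ℝ UR[k + l]) ∧
      jRightR k l z ^ d + ∑ i ∈ Finset.range d, c i * jRightR k l z ^ i ∈ uRightR (𝕜 := 𝕜) k l := by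
  refine exists_monic_mem_uRightR_of_antiR ?_
  rw [antiR_jRightR]
  exact exists_monic_mem_uIdealR_jRightR _ (antiR_mem_center hz)

end RCRight

end Literature.NumberTheory.Automorphic.HCLevi
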